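import Mathlib.Analysis.SpecialFunctions.Exp
import Mathlib.Analysis.SpecialFunctions.Pow.Real
import Mathlib.Order.Filter.AtTopBot.Archimedean
import HarnessLib

/-!
# Crux `NearConstantShortTimeHL` (stmt-AtomisticToContinuum-12502), line `small-tilt-domination` — elementary limits for the bookkeeping of the
dynamic theorem (`stub_dynamic`)

Two real-analysis facts used when the relative-entropy Grönwall bound `D(t) ≤ (A + β'E) e^{β't}` is pushed to the limit: the cubic Gaussian tail
level `L` can be chosen so that `K L³ e^{−aL²} e^{b(1+L)+c}` is small (the Gaussian factor beats the Grönwall exponential, which is only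
exponential in `L`), and `(ι_N + 1)⁻¹ → 0` along a diverging integer sequence. Pure calculus.
-/

noncomputable section

namespace Summit.AtomisticToContinuum.HydrodynamicLimit.Theorems.NearConstantShortTimeHL

open Filter Topology Set

/-- **Choice of the cubic-tail level.** For `a > 0`, `K ≥ 0` and any `b, c, Lmin`, `ε > 0` there is `L ≥ max(Lmin, 1)` with
`K L³ e^{−aL²} e^{b(1+L)+c} ≤ ε` (for `L ≥ (|b|+1)/a` one has `−aL² + bL ≤ −L`, and `L³e^{−L} → 0`). Registered helper of `stub_dynamic`.
[folklore] -/
theorem dyn_exists_level : ∀ {a : ℝ}, 0 < a → ∀ (b c K Lmin ε : ℝ), 0 ≤ K → 0 < ε → ∃ L : ℝ, Lmin ≤ L ∧ 1 ≤ L ∧ K * L ^ 3 * Real.exp (-(a * L ^ 2)) * Real.exp (b * (1 + L) + c) ≤ ε := by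
  intro a ha b c K Lmin ε hK hε
  have hlim := Real.tendsto_pow_mul_exp_neg_atTop_nhds_zero 3
  set M : ℝ := K * Real.exp (b + c) + 1 with hM
  have hM0 : 0 < M := by positivity
  have hev : ∀ᶠ L : ℝ in atTop, L ^ 3 * Real.exp (-L) < ε / M := hlim.eventually (gt_mem_nhds (by positivity))
  obtain ⟨L, hL⟩ := (hev.and ((eventually_ge_atTop Lmin).and ((eventually_ge_atTop (1 : ℝ)).and
    (eventually_ge_atTop ((|b| + 1) / a))))).exists
  obtain ⟨h1, hLmin, hL1, hLb⟩ := hL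
  refine ⟨L, hLmin, hL1, ?_⟩
  have hL0 : 0 ≤ L := zero_le_one.trans hL1
  -- `-aL² + b(1+L) + c ≤ (b + c) - L`
  have hquad : -(a * L ^ 2) + (b * (1 + L) + c) ≤ (b + c) - L := by
    have haL : |b| + 1 ≤ a * L := by rw [div_le_iff₀ ha] at hLb; linarith
    have : b * L ≤ |b| * L := mul_le_mul_of_nonneg_right (le_abs_self b) hL0
    nlinarith
  calc K * L ^ 3 * Real.exp (-(a * L ^ 2)) * Real.exp (b * (1 + L) + c)
      = K * (L ^ 3 * Real.exp (-(a * L ^ 2) + (b * (1 + L) + c))) := by rw [Real.exp_add (-(a * L ^ 2))]; ring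
    _ ≤ K * (L ^ 3 * Real.exp ((b + c) - L)) := by
        refine mul_le_mul_of_nonneg_left (mul_le_mul_of_nonneg_left (Real.exp_le_exp.2 hquad) (by positivity)) hK
    _ = K * Real.exp (b + c) * (L ^ 3 * Real.exp (-L)) := by rw [sub_eq_add_neg, Real.exp_add]; ring
    _ ≤ M * (L ^ 3 * Real.exp (-L)) := by
        refine mul_le_mul_of_nonneg_right (by linarith) (by positivity)
    _ ≤ M * (ε / M) := mul_le_mul_of_nonneg_left h1.le hM0.le
    _ = ε := mul_div_cancel₀ ε hM0.ne'

/-- Along a diverging integer sequence, `(ι_N + 1)⁻¹ → 0`. [folklore] -/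
theorem dyn_tendsto_inv_succ {ι : ℕ → ℕ} (hι : Tendsto ι atTop atTop) :
    Tendsto (fun N => ((ι N : ℝ) + 1)⁻¹) atTop (𝓝 0) := by
  have h1 : Tendsto (fun N => (ι N : ℝ) + 1) atTop atTop :=
    tendsto_atTop_add_const_right _ _ (tendsto_natCast_atTop_atTop.comp hι)
  exact tendsto_inv_atTop_zero.comp h1

/-- Along a diverging integer sequence, `c / ι_N → 0`. [folklore] -/
theorem dyn_tendsto_const_div {ι : ℕ → ℕ} (hι : Tendsto ι atTop atTop) (c : ℝ) :
    Tendsto (fun N => c / (ι N : ℝ)) atTop (𝓝 0) := by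
  have h1 : Tendsto (fun N => (ι N : ℝ)) atTop atTop := tendsto_natCast_atTop_atTop.comp hι
  simpa using h1.const_div_atTop c

/-- Along a diverging integer sequence, `c/(ι_N+1)² → 0` and `ι_N · c/(ι_N+1)² → 0`. [folklore] -/
theorem dyn_tendsto_defect {ι : ℕ → ℕ} (hι : Tendsto ι atTop atTop) (c : ℝ) :
    Tendsto (fun N => c / ((ι N : ℝ) + 1) ^ 2) atTop (𝓝 0) ∧
      Tendsto (fun N => (ι N : ℝ) * (c / ((ι N : ℝ) + 1) ^ 2)) atTop (𝓝 0) := by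
  have h0 := dyn_tendsto_inv_succ hι
  have hsq : Tendsto (fun N => c / ((ι N : ℝ) + 1) ^ 2) atTop (𝓝 0) := by
    have : Tendsto (fun N => c * (((ι N : ℝ) + 1)⁻¹ * ((ι N : ℝ) + 1)⁻¹)) atTop (𝓝 (c * (0 * 0))) := (h0.mul h0).const_mul c
    rw [mul_zero, mul_zero] at this
    refine this.congr fun N => ?_
    rw [div_eq_mul_inv, ← mul_inv, sq]
  refine ⟨hsq, ?_⟩
  -- `ι c/(ι+1)² = c (ι/(ι+1)) (ι+1)⁻¹`, and `ι/(ι+1) ≤ 1`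
  have hb : Tendsto (fun N => |c| * ((ι N : ℝ) + 1)⁻¹) atTop (𝓝 (|c| * 0)) := h0.const_mul _
  rw [mul_zero] at hb
  refine squeeze_zero_norm (fun N => ?_) hb
  have hι0 : (0 : ℝ) ≤ ι N := Nat.cast_nonneg _
  have hι1 : (0 : ℝ) < (ι N : ℝ) + 1 := by linarith
  rw [Real.norm_eq_abs, abs_mul, abs_of_nonneg hι0, abs_div, abs_of_pos (pow_pos hι1 2)]
  rw [show (ι N : ℝ) * (|c| / ((ι N : ℝ) + 1) ^ 2) = (|c| * ((ι N : ℝ) + 1)⁻¹) * ((ι N : ℝ) / ((ι N : ℝ) + 1)) by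
    field_simp]
  have hle : (ι N : ℝ) / ((ι N : ℝ) + 1) ≤ 1 := by rw [div_le_one hι1]; linarith
  have hge : 0 ≤ (ι N : ℝ) / ((ι N : ℝ) + 1) := by positivity
  calc |c| * ((ι N : ℝ) + 1)⁻¹ * ((ι N : ℝ) / ((ι N : ℝ) + 1)) ≤ |c| * ((ι N : ℝ) + 1)⁻¹ * 1 :=
        mul_le_mul_of_nonneg_left hle (by positivity)
    _ = |c| * ((ι N : ℝ) + 1)⁻¹ := mul_one _

end Summit.AtomisticToContinuum.HydrodynamicLimit.Theorems.NearConstantShortTimeHL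

end
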